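import Summits.QuantumFields.YangMills.Theorems.BalabanUVNodesN19HybridChainRule
import Literature.MathematicalPhysics.QuantumFieldTheory.Balaban1983to89.T4ApexHybrid

/-!
# YM-DAG node N19 (= NE7 proper) — THE HYBRID CHAIN RULE, part 2: run SYMMETRY of the binder list, THREE legs («truncate – merge – un-truncate»),
# and a TOWER of `n + 1` legs in the from-`K₀`-on ∃-currency

Cell `pub-ymgap`, HUMAN RULING D-0062 (Track A) + D-0149 (width seats, director-ym №197), WIDTH SEAT `pub-ymgap-dag-n19-w1` (N19 NE7, seat 1 of 3),
generation g6, FILE 2; bus CLAIM-2 (HOME `INBOX.md`).  Route `Summits/QuantumFields/YangMills/Theses/BalabanUVNodes.lean`, key item K3⁸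
«SpineGivenEndpointR13SepCoPHV» (stmt-QuantumFields-27366; K3⁷ stmt-QuantumFields-20544 = aside lineage); filed `--kind proof --supports` that item
`--as helper`.  COUNT-NEUTRAL.  THEOREMS ONLY; 0 `def`; 0 `sorry`; standard axioms.  Imports FILE 1 `…N19HybridChainRule` (p-id in the bus line) only.

THE POINT (numbers, not adjectives).  FILE 1's `hybridNE7_trans` composes TWO legs `A → M → B` of the hybrid binder list
`T4MatchingAssembly.HybridNE7` into the `K₀`-shifted composite; `hybridNE7Edge_trans` is its ∃-currency.  A route that telescopes through SEVERAL
intermediate families — the window road's three legs «run A → its window truncation A♭ → run B's window truncation B♭ → run B» (legs 1 and 3 are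
ONE-RUN letters: a run against its own truncation; only leg 2 compares the two runs, at the window), or a tower of partial resummations
`R 0 → R 1 → ⋯ → R (n + 1)` — needs (i) the binder list read in EITHER direction (§1: `hybridNE7_symm`, the two runs swap; NE7 proper by dag-n19-e's
`N19CoreMetric.core_symm`, NE7b ∕ NE7c by exchanging their left ∕ right clauses), (ii) origin shifts that ACCUMULATE (§2: a `K₁`-shift of `K₀`-shifted
data is the `(K₀ + K₁)`-shift — `Nat.add_assoc` under the binders), and (iii) the legs chained: §3 `hybridNE7Edge_trans₃` (three legs, two applications
of FILE 1 with the third leg shifted to the first composite's origin) and §4 ★★ `hybridNE7Edge_chain` (ANY `n + 1` consecutive legs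
`R i → R (i + 1)`, `i ≤ n`, each for SOME bad classes ∕ weights ∕ shell weight ∕ radius with the shells `sh i` shared by adjacent legs ⇒ for some `K₀`
the `K₀`-shifted end pair `(R 0, R (n + 1))` carries the binder list for some bad classes ∕ weights ∕ shell weight ∕ radius, end shells `sh 0 ∕ sh (n + 1)`;
induction on `n`, each step = shift the next leg to the current origin (FILE 1 `hybridNE7_shift`), compose (FILE 1 `hybridNE7_trans`), re-associate).
The number of legs is FIXED in `K` (a tower whose length grows with `K` is not a chain of `HybridNE7` data and is not treated).  §5 `hybridNE7EdgeFrom_trans`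
(legs from DIFFERENT origins).  §6 ★★ `stringHybridNE7_of_legs` (the per-string socket: legs at a string's E1∕E2 dictionary ⇒ `∃ K₁, StringHybridNE7 S os l₀ vol (K₀ + K₁)`)
and §7 ★★★ `hybridNE7Under_of_legs` (the B5 socket: binder `T4ApexHybrid.HybridNE7Under D Hβ` — K3⁸'s conclusion at a slot datum — from legs per string under the prefix;
the origin is EXISTENTIAL in B5's currency (dag-n27-a's `hybridNE7Under_iff_spineNodes_tail`), so FILE 1's from-`K₀`-on composite needs NO smallness binder there).

READING (located; nothing proposed).  In the binder-list currency the window road of this seat's g4 (`…N19OneDatumTwoKeys`, `…N19WindowTruncationKey`)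
is `hybridNE7Edge_trans₃` with `M₁ ∕ M₂` the two runs' window truncations: its legs 1 and 3 are FADING-MEMORY letters of ONE run each (the kind the
programme prints uniformly in `ε`, cf. node N22's `T4OutputRate.FadingMemory` slot), and all two-run content sits in leg 2 at the window key — where
g4's law merge (`…N19RekeyingAbsorptionClassForm.hybridNE7_of_classFactorisation`) and g5's tail letter live.  Nothing here produces a leg.

HONEST FRAMING.  NE7 ∕ NE7b ∕ NE7c are NOT PRINTED as two-run statements for d = 4 ([Balaban1987RG1]–[Balaban1989LargeFieldII] bound ONE run uniformly in
`ε`; printed template [King1986] (3.10)–(3.13) pp. 656–657, context only) and NOT PROVED; all term families, shells, bad classes, weights and radii are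
ABSTRACT and every leg is a HYPOTHESIS; nothing of Bałaban's is asserted or instantiated; N19 ∕ N20 ∕ N21 NOT discharged; K3⁸ OPEN, «v6» untouched; Track A
counts UNMOVED (typed 28∕28 · discharged 5∕27).  One finite four-torus at fixed ε, rung (B)+1: R4 closes the conditional finite-𝕋⁴ rung `BalabanLadder.UV`
only — NOT infinite volume, NOT OS on ℝ⁴, NOT a mass gap; the YM mass gap (Clay) is NOT proved by any of this.
-/

set_option autoImplicit false

noncomputable section

open Finset Filter Topology
open scoped BigOperators

namespace Summit.QuantumFields.YangMills.BalabanUVNodes.N19HybridChainRuleTower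

open Literature.MathematicalPhysics.QuantumFieldTheory.Balaban1983to89
open T4WeightBudget (RelWeightBound)
open T4IndicatorShell (ShellWeightBound)
open T4MatchingAssembly (HybridNE7 hybridNE7_of_relWeightBound)
open Summit.QuantumFields.BalabanUV.T4Continuum.Spine
open Summit.QuantumFields.YangMills.BalabanUVNodes.N19CoreMetric (core_symm)
open Summit.QuantumFields.YangMills.BalabanUVNodes.N19HybridChainRule (hybridNE7_shift hybridNE7_trans hybridNE7Edge_trans)

/-! ## §1 Run symmetry of the binder list [folklore] -/

section Symm

variable {ι : Type*} [DecidableEq ι] {l₀ vol : ℝ} {T : ℕ → Finset ι} {A B shA shB : ℕ → ℝ → ι → ℝ} {Bad : ℕ → ℝ → Finset ι}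
  {W Wsh δ : ℕ → ℝ}

omit [DecidableEq ι] in
/-- NE7b is symmetric in the two runs (its two mass clauses swap). [folklore] -/
theorem relWeightBound_symm (h : RelWeightBound l₀ T A B Bad W) : RelWeightBound l₀ T B A Bad W where
  bad_subset := h.bad_subset
  nonneg := h.nonneg
  lt_one := h.lt_one
  summable := h.summable
  bad_left := h.bad_right
  bad_right := h.bad_left

omit [DecidableEq ι] in
/-- NE7c is symmetric in the two runs (the shells travel with their runs). [folklore] -/
theorem shellWeightBound_symm (h : ShellWeightBound l₀ T A B shA shB Wsh) : ShellWeightBound l₀ T B A shB shA Wsh where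
  nonneg := h.nonneg
  summable := h.summable
  sh_nonneg_left := h.sh_nonneg_right
  sh_le_left := h.sh_le_right
  sh_nonneg_right := h.sh_nonneg_left
  sh_le_right := h.sh_le_left
  left := h.right
  right := h.left

/-- **THE BINDER LIST IS SYMMETRIC IN THE TWO RUNS** [folklore]: `HybridNE7 … A B Bad W shA shB Wsh δ → HybridNE7 … B A Bad W shB shA Wsh δ` (same bad
classes, weights, radius; NE7 proper by `N19CoreMetric.core_symm`, constants `c ↦ −c`). -/
theorem hybridNE7_symm (h : HybridNE7 l₀ vol T A B Bad W shA shB Wsh δ) : HybridNE7 l₀ vol T B A Bad W shB shA Wsh δ :=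
  hybridNE7_of_relWeightBound (relWeightBound_symm h.weight) (shellWeightBound_symm h.shell) h.lt_one h.summable (core_symm h.core)

/-- … as an equivalence. [folklore] -/
theorem hybridNE7_symm_iff : HybridNE7 l₀ vol T A B Bad W shA shB Wsh δ ↔ HybridNE7 l₀ vol T B A Bad W shB shA Wsh δ :=
  ⟨hybridNE7_symm, hybridNE7_symm⟩

end Symm

/-! ## §2 Origin shifts accumulate [bookkeeping] -/

section ShiftShift

variable {ι : Type*} [DecidableEq ι] {l₀ vol : ℝ} {T : ℕ → Finset ι} {A B shA shB : ℕ → ℝ → ι → ℝ} {Bad : ℕ → ℝ → Finset ι}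
  {W Wsh δ : ℕ → ℝ}

/-- A `K₁`-shift of `K₀`-shifted data IS the `(K₀ + K₁)`-shifted data (`Nat.add_assoc` under the binders). [folklore] -/
theorem hybridNE7_shift_shift_iff (K₀ K₁ : ℕ) :
    HybridNE7 l₀ vol (fun K => T (K₀ + (K₁ + K))) (fun K => A (K₀ + (K₁ + K))) (fun K => B (K₀ + (K₁ + K)))
        (fun K => Bad (K₀ + (K₁ + K))) (fun K => W (K₀ + (K₁ + K))) (fun K => shA (K₀ + (K₁ + K))) (fun K => shB (K₀ + (K₁ + K)))
        (fun K => Wsh (K₀ + (K₁ + K))) (fun K => δ (K₀ + (K₁ + K))) ↔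
      HybridNE7 l₀ vol (fun K => T (K₀ + K₁ + K)) (fun K => A (K₀ + K₁ + K)) (fun K => B (K₀ + K₁ + K)) (fun K => Bad (K₀ + K₁ + K))
        (fun K => W (K₀ + K₁ + K)) (fun K => shA (K₀ + K₁ + K)) (fun K => shB (K₀ + K₁ + K)) (fun K => Wsh (K₀ + K₁ + K))
        fun K => δ (K₀ + K₁ + K) := by
  simp only [Nat.add_assoc]

/-- Shifting twice: from the binder list of the data, its `(K₀ + K₁)`-shift via two single shifts (FILE 1 `hybridNE7_shift`). [folklore] -/
theorem hybridNE7_shift_add (K₀ K₁ : ℕ) (h : HybridNE7 l₀ vol T A B Bad W shA shB Wsh δ) :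
    HybridNE7 l₀ vol (fun K => T (K₀ + K₁ + K)) (fun K => A (K₀ + K₁ + K)) (fun K => B (K₀ + K₁ + K)) (fun K => Bad (K₀ + K₁ + K))
      (fun K => W (K₀ + K₁ + K)) (fun K => shA (K₀ + K₁ + K)) (fun K => shB (K₀ + K₁ + K)) (fun K => Wsh (K₀ + K₁ + K))
      fun K => δ (K₀ + K₁ + K) :=
  hybridNE7_shift (K₀ + K₁) h

end ShiftShift

/-! ## §3 Three legs: «truncate – merge – un-truncate» [folklore] -/

section Three

variable {ι : Type*} [DecidableEq ι] {l₀ vol : ℝ} {T : ℕ → Finset ι} {A M₁ M₂ B shA sh₁ sh₂ shB : ℕ → ℝ → ι → ℝ}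

/-- ★ **THREE LEGS COMPOSE** [folklore]: `A → M₁`, `M₁ → M₂`, `M₂ → B`, each carrying the binder list for SOME bad classes ∕ weights ∕ shell weight ∕
radius (adjacent legs sharing the middle shells `sh₁`, `sh₂`) ⇒ for some `K₀` the `K₀`-shifted pair `(A, B)` carries it for some bad classes ∕ weights ∕
shell weight ∕ radius, end shells `shA ∕ shB`.  (FILE 1 twice: compose legs 1–2 from some `K₁` on, shift leg 3 to `K₁`, compose from some further `K₂` on,
re-associate to `K₀ = K₁ + K₂`.)  The window-road shape: `M₁ ∕ M₂` = the two runs' window truncations, legs 1 and 3 one-run fading-memory letters. -/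
theorem hybridNE7Edge_trans₃
    (h₁ : ∃ (Bad : ℕ → ℝ → Finset ι) (W Wsh δ : ℕ → ℝ), HybridNE7 l₀ vol T A M₁ Bad W shA sh₁ Wsh δ)
    (h₂ : ∃ (Bad : ℕ → ℝ → Finset ι) (W Wsh δ : ℕ → ℝ), HybridNE7 l₀ vol T M₁ M₂ Bad W sh₁ sh₂ Wsh δ)
    (h₃ : ∃ (Bad : ℕ → ℝ → Finset ι) (W Wsh δ : ℕ → ℝ), HybridNE7 l₀ vol T M₂ B Bad W sh₂ shB Wsh δ) :
    ∃ (K₀ : ℕ) (Bad : ℕ → ℝ → Finset ι) (W Wsh δ : ℕ → ℝ),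
      HybridNE7 l₀ vol (fun K => T (K₀ + K)) (fun K => A (K₀ + K)) (fun K => B (K₀ + K)) Bad W
        (fun K => shA (K₀ + K)) (fun K => shB (K₀ + K)) Wsh δ := by
  obtain ⟨K₁, Bad, W, Wsh, δ, h12⟩ := hybridNE7Edge_trans h₁ h₂
  obtain ⟨Bad₃, W₃, Wsh₃, δ₃, h₃⟩ := h₃
  obtain ⟨K₂, h⟩ := hybridNE7_trans h12 (hybridNE7_shift K₁ h₃)
  simp only [← Nat.add_assoc] at h
  exact ⟨K₁ + K₂, _, _, _, _, h⟩

end Three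

/-! ## §4 A tower of `n + 1` legs [folklore] -/

section Tower

variable {ι : Type*} [DecidableEq ι] {l₀ vol : ℝ} {T : ℕ → Finset ι}

/-- ★★ **A TOWER OF LEGS COMPOSES** [folklore]: families `R 0, R 1, …, R (n + 1)` with shells `sh i` and, for every `i ≤ n`, the binder list of the leg
`R i → R (i + 1)` for SOME bad classes ∕ weights ∕ shell weight ∕ radius (shells `sh i ∕ sh (i + 1)`) ⇒ for some `K₀` the `K₀`-shifted end pair
`(R 0, R (n + 1))` carries the binder list for some bad classes ∕ weights ∕ shell weight ∕ radius, end shells `sh 0 ∕ sh (n + 1)`.  Induction on `n`: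
shift the next leg to the current origin, compose by FILE 1, re-associate the origins.  The tower's length is FIXED in `K`. -/
theorem hybridNE7Edge_chain (R sh : ℕ → ℕ → ℝ → ι → ℝ) :
    ∀ n : ℕ, (∀ i ≤ n, ∃ (Bad : ℕ → ℝ → Finset ι) (W Wsh δ : ℕ → ℝ),
        HybridNE7 l₀ vol T (R i) (R (i + 1)) Bad W (sh i) (sh (i + 1)) Wsh δ) →
      ∃ (K₀ : ℕ) (Bad : ℕ → ℝ → Finset ι) (W Wsh δ : ℕ → ℝ),
        HybridNE7 l₀ vol (fun K => T (K₀ + K)) (fun K => R 0 (K₀ + K)) (fun K => R (n + 1) (K₀ + K)) Bad W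
          (fun K => sh 0 (K₀ + K)) (fun K => sh (n + 1) (K₀ + K)) Wsh δ
  | 0, h => by
    obtain ⟨Bad, W, Wsh, δ, h0⟩ := h 0 le_rfl
    exact ⟨0, _, _, _, _, hybridNE7_shift 0 h0⟩
  | n + 1, h => by
    obtain ⟨K₀, Bad, W, Wsh, δ, hc⟩ := hybridNE7Edge_chain R sh n fun i hi => h i (hi.trans (Nat.le_succ n))
    obtain ⟨Bad', W', Wsh', δ', hl⟩ := h (n + 1) le_rfl
    obtain ⟨K₁, h2⟩ := hybridNE7_trans hc (hybridNE7_shift K₀ hl)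
    simp only [← Nat.add_assoc] at h2
    exact ⟨K₀ + K₁, _, _, _, _, h2⟩

/-- The tower read backwards (run symmetry, §1): the same hypotheses give the binder list of the shifted REVERSED end pair `(R (n + 1), R 0)`. [folklore] -/
theorem hybridNE7Edge_chain_symm (R sh : ℕ → ℕ → ℝ → ι → ℝ) (n : ℕ)
    (h : ∀ i ≤ n, ∃ (Bad : ℕ → ℝ → Finset ι) (W Wsh δ : ℕ → ℝ),
      HybridNE7 l₀ vol T (R i) (R (i + 1)) Bad W (sh i) (sh (i + 1)) Wsh δ) :
    ∃ (K₀ : ℕ) (Bad : ℕ → ℝ → Finset ι) (W Wsh δ : ℕ → ℝ),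
      HybridNE7 l₀ vol (fun K => T (K₀ + K)) (fun K => R (n + 1) (K₀ + K)) (fun K => R 0 (K₀ + K)) Bad W
        (fun K => sh (n + 1) (K₀ + K)) (fun K => sh 0 (K₀ + K)) Wsh δ := by
  obtain ⟨K₀, Bad, W, Wsh, δ, hc⟩ := hybridNE7Edge_chain R sh n h
  exact ⟨K₀, Bad, W, Wsh, δ, hybridNE7_symm hc⟩

end Tower

/-! ## §5 Legs from DIFFERENT origins [folklore] -/

section Origins

variable {ι : Type*} [DecidableEq ι] {l₀ vol : ℝ} {T : ℕ → Finset ι} {A M B shA shM shB : ℕ → ℝ → ι → ℝ}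

/-- ★★ **TRANSITIVITY OF «FROM SOME LEVEL ON»** [folklore]: leg `A → M` from origin `K₁` and leg `M → B` from origin `K₂` (each for SOME bad classes ∕
weights ∕ shell weight ∕ radius, middle shell `shM`) ⇒ `A → B` from some origin `K₀` (bring both legs to the common origin `K₁ + K₂` by FILE 1
`hybridNE7_shift`, compose, re-associate).  The form in which per-string data are held (`T4MatchingAssembly.StringHybridNE7 S os l₀ vol K₀`). -/
theorem hybridNE7EdgeFrom_trans {K₁ K₂ : ℕ}
    (h₁ : ∃ (Bad : ℕ → ℝ → Finset ι) (W Wsh δ : ℕ → ℝ), HybridNE7 l₀ vol (fun K => T (K₁ + K)) (fun K => A (K₁ + K))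
      (fun K => M (K₁ + K)) Bad W (fun K => shA (K₁ + K)) (fun K => shM (K₁ + K)) Wsh δ)
    (h₂ : ∃ (Bad : ℕ → ℝ → Finset ι) (W Wsh δ : ℕ → ℝ), HybridNE7 l₀ vol (fun K => T (K₂ + K)) (fun K => M (K₂ + K))
      (fun K => B (K₂ + K)) Bad W (fun K => shM (K₂ + K)) (fun K => shB (K₂ + K)) Wsh δ) :
    ∃ (K₀ : ℕ) (Bad : ℕ → ℝ → Finset ι) (W Wsh δ : ℕ → ℝ),
      HybridNE7 l₀ vol (fun K => T (K₀ + K)) (fun K => A (K₀ + K)) (fun K => B (K₀ + K)) Bad W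
        (fun K => shA (K₀ + K)) (fun K => shB (K₀ + K)) Wsh δ := by
  obtain ⟨Bad₁, W₁, Wsh₁, δ₁, h₁⟩ := h₁
  obtain ⟨Bad₂, W₂, Wsh₂, δ₂, h₂⟩ := h₂
  have h₁' := hybridNE7_shift K₂ h₁
  have h₂' := hybridNE7_shift K₁ h₂
  simp only [Nat.add_left_comm K₂ K₁] at h₂'
  obtain ⟨K₃, h⟩ := hybridNE7_trans h₁' h₂'
  simp only [← Nat.add_assoc] at h
  exact ⟨K₁ + K₂ + K₃, _, _, _, _, h⟩

end Origins

/-! ## §6 The per-string socket [bookkeeping] -/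

section PerString

open Missing T4Continuum T4Assembly
open T4MatchingAssembly (StringHybridNE7)

variable {G : Type*} [GaugeGroup G] [MeasurableSpace G] [HaarData G] {O : Type*}

/-- ★★ **AN INTERMEDIATE FAMILY AT A STRING'S DICTIONARY CLOSES THE PER-STRING DATUM FROM SOME LEVEL ON** [bookkeeping].  If the string `os` of a
scheme `S` has its dressed partition functions after `K₀ + K` resp. `K₀ + K + 1` steps identified on `|t| ≤ l₀` with the term sums of two families `A`,
`B` (the E1∕E2 dictionary of `T4MatchingAssembly.StringHybridNE7`), and some family `M` on the same carriers sits between them with two hybrid legs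
`A → M`, `M → B` (middle shell shared), then `∃ K₁, StringHybridNE7 S os l₀ vol (K₀ + K₁)` — literally the per-string input of the kernel's
`T4MatchingAssembly.hasContinuumLimit_of_hybridNE7` ∕ `T4MatchingClosureHosts.hasContinuumLimit_of_stringClosures` (FILE 1 `hybridNE7_trans`, packaged by
`T4MatchingClosure.stringHybridNE7_of_shift`).  `M` needs NO dictionary: it is not a run of the scheme. -/
theorem stringHybridNE7_of_legs (S : TorusScheme G O) (os : List O) (K₀ : ℕ) {ι : Type} [DecidableEq ι] {l₀ vol : ℝ}
    {T : ℕ → Finset ι} {A M B shA shM shB : ℕ → ℝ → ι → ℝ} {Bad₁ Bad₂ : ℕ → ℝ → Finset ι} {W₁ W₂ Wsh₁ Wsh₂ δ₁ δ₂ : ℕ → ℝ}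
    (h₁ : HybridNE7 l₀ vol T A M Bad₁ W₁ shA shM Wsh₁ δ₁) (h₂ : HybridNE7 l₀ vol T M B Bad₂ W₂ shM shB Wsh₂ δ₂)
    (hZA : ∀ K t, |t| ≤ l₀ → T4GenFunBounds.schemeZ S os (K₀ + K) t = ∑ τ ∈ T K, A K t τ)
    (hZB : ∀ K t, |t| ≤ l₀ → T4GenFunBounds.schemeZ S os (K₀ + K + 1) t = ∑ τ ∈ T K, B K t τ) :
    ∃ K₁ : ℕ, StringHybridNE7 S os l₀ vol (K₀ + K₁) := by
  obtain ⟨K₁, h⟩ := hybridNE7_trans h₁ h₂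
  exact ⟨K₁, T4MatchingClosure.stringHybridNE7_of_shift (Bad := fun K t => Bad₁ K t ∪ Bad₂ K t) S os K₀ K₁ h hZA hZB⟩

end PerString

/-! ## §7 The B5 socket: legs under a datum's prefix ⇒ `T4ApexHybrid.HybridNE7Under` [bookkeeping] -/

section Apex

open Missing T4Continuum T4Assembly
open T4MatchingAssembly (StringHybridNE7)

variable {F : T4Family} {G : Type*} [GaugeGroup G] [MeasurableSpace G] [HaarData G]

/-- ★★★ **BINDER B5 FROM TWO LEGS PER STRING, UNDER THE PREFIX** [bookkeeping].  `T4ApexHybrid.HybridNE7Under D Hβ` — the spine's composite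
node (K3⁸'s conclusion at each slot datum) — is, by dag-n27-a's `…N27BudgetRedundant.hybridNE7Under_iff_spineNodes_tail`, the per-string package «SOME carriers from SOME
origin `K₀` with N20 ∧ N21 ∧ N19 ∧ `Summable δ` ∧ E1∕E2» under `D.UnderHypotheses Hβ`, the origin EXISTENTIAL.  Hence FILE 1's from-`K₀`-on chain rule plugs in with NO
smallness binder and NO all-terms radius: if under the prefix every string `os` has carriers from some origin `K₀` carrying the two runs' E1∕E2 dictionary for families `A`,
`B` and SOME intermediate family `M` (shells `shM`) with two hybrid legs `A → M → B`, then `HybridNE7Under D Hβ` (§6 per string, then the offset `K₀ + K₁` is absorbed by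
the existential — `T4ContinuumYM4Torus`∕`T4Continuum.FiniteEpsData.UnderHypotheses.mono`).  The legs are HYPOTHESES; nothing of Bałaban's is produced. -/
theorem hybridNE7Under_of_legs (D : FiniteEpsData F G) {Hβ : Prop}
    (h : D.UnderHypotheses Hβ fun g₀ => ∀ os : List (ULoop F),
      ∃ (ι : Type) (_ : DecidableEq ι) (l₀ vol : ℝ) (K₀ : ℕ) (T : ℕ → Finset ι) (A M B shA shM shB : ℕ → ℝ → ι → ℝ),
        0 < l₀ ∧ 0 < vol ∧
          (∃ (Bad : ℕ → ℝ → Finset ι) (W Wsh δ : ℕ → ℝ), HybridNE7 l₀ vol T A M Bad W shA shM Wsh δ) ∧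
          (∃ (Bad : ℕ → ℝ → Finset ι) (W Wsh δ : ℕ → ℝ), HybridNE7 l₀ vol T M B Bad W shM shB Wsh δ) ∧
          (∀ (K : ℕ) (t : ℝ), |t| ≤ l₀ → T4GenFunBounds.schemeZ (D.scheme g₀) os (K₀ + K) t = ∑ τ ∈ T K, A K t τ) ∧
          (∀ (K : ℕ) (t : ℝ), |t| ≤ l₀ → T4GenFunBounds.schemeZ (D.scheme g₀) os (K₀ + K + 1) t = ∑ τ ∈ T K, B K t τ)) :
    T4ApexHybrid.HybridNE7Under D Hβ :=
  FiniteEpsData.UnderHypotheses.mono (fun g₀ hg os => by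
    obtain ⟨ι, _, l₀, vol, K₀, T, A, M, B, shA, shM, shB, hl₀, hvol, ⟨Bad₁, W₁, Wsh₁, δ₁, h₁⟩, ⟨Bad₂, W₂, Wsh₂, δ₂, h₂⟩, hE1, hE2⟩ :=
      hg os
    obtain ⟨K₁, hS⟩ := stringHybridNE7_of_legs (D.scheme g₀) os K₀ h₁ h₂ hE1 hE2
    exact ⟨l₀, vol, K₀ + K₁, hl₀, hvol, hS⟩) h

end Apex

end Summit.QuantumFields.YangMills.BalabanUVNodes.N19HybridChainRuleTower

end
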